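import Literature.MathematicalPhysics.QuantumFieldTheory.Balaban1983to89.T4Continuum
import Literature.MathematicalPhysics.QuantumFieldTheory.Balaban1983to89.FlowStepRuns
import Mathlib.Topology.Order.LeftRightNhds

/-!
# Crux K1⁷ ∕ K2⁷ — THE `K ≥ 1` SMALL-COUPLING WINDOW OF A FORWARD-GENERATED CONSTRUCTION FROM FIRST-STEP INPUTS ONLY
# (flow side, for every `DagBinding.ForwardGenerated` construction and every finite-ε datum `D : FiniteEpsData F G`)

Cell `pub-ymgap`, YM-PLAN Track A (HUMAN RULING D-0062 ∕ D-0149, director-ym №197), WIDTH SEAT `pub-ymgap-dag-n13-w4` (g0) on NODE n13 [Balaban1989LargeFieldII]; helper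
(`--supports`) for crux K1⁷ `StabilityBAtRecordR13SepCoPH` = stmt-QuantumFields-20542, whose last conjunct — and the window hypothesis of K2⁷ `EndpointGivenBR13SepCoPH` — is
the `K ≥ 1` WINDOW `∃ γ₁ > 0, ∀ γ ∈ ]0, γ₁], ∃ P, 1 ≤ P.K ∧ (D.C P).flow.InInterval γ P.K` (plan g73 skeleton v5 `K1Skeleton13SepCoPHv5.lean` 38c62055d1ac34a4, rung 2).  FILE 1 of 2
(W-SEAT-START-LIST v3 §1 n13 ITEM 4 = n24 ITEM 2); file 2 `…N13WindowAtRecord13SepCoPH` reads this at NODE 00's Stage-13 datum of record.  COUNT-NEUTRAL.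

CONTENT.  The couplings of a finite-ε datum are generated FORWARD from the bare coupling by [Balaban1987RG1] (0.18)∕(0.20) with its history-dependent β-functions (dictionary
fields `D.fwd`, `D.curries`).  For a GENERATED sequence `genSeq β g₀` node00-def-K0a's ROW W12 (`Node00/Record12NumericsWindow`: `window_genSeq_iff`) shows the window IS the
FIRST-STEP CONDITION «∀ small γ, ∃ g₀ ∈ ]0, γ] with `β 0 (g₀) ≤ 1∕g₀² − 1∕γ²`» — ONE real function, the first β-function near `0⁺`, nothing else.  This file proves that the
same condition is SUFFICIENT for every merely forward-generated construction (`DagBinding.ForwardGenerated`, no halting clause needed: a good first step IS the run `⟨1, m, g₀⟩`)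
and derives it from each located input the K1⁷ chain holds, weakest first: `g²·β 0 (g) ≤ c < 1` eventually at `0⁺` (a divergence like `c∕g²` is tolerated; cf. W12's necessary
`sq_mul_betaMerged_lt_one_of_window`); `β 0` eventually bounded above at `0⁺`; the one-sided LIMIT of `β 0` at `0⁺` exists (a continuity input — [I] p. 264 β-clause ∕ (2.12)–(2.14)
p. 268); a level-0 bound `β 0 (g) ≤ β⁺` on `]0, γ₁]` = the `k = 0` instance of [I] p. 264 «β_k(g) … uniformly bounded on this interval» (proof deferred in print; cell census
T09.F ∕ NODE O); the INTERVAL binder `DagBinding.BetaBoundsInInterval C γ₀ b b′` of K1⁷'s rung 2 (its upper letter at `j = 0`, through `CurriesHBeta`).  By name elsewhere: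
dag-n24-a's `Node00.N24_window_allK_of_betaUpperH` (ALL-STEP box bound ⟹ runs of every length), `…N27SpineGivenEndpointR11Vacuity.window_of_endpointExistence`
(`DagBinding.EndpointExistence C.toB12` ⟹ the window — K2⁷'s window hypothesis is implied by its conclusion).

WHAT THIS FILE PROVES (theorems only, 0 `def`, 0 `sorry`).
* §1 `const_mem_box_zero_iff` · ★ `oneStep_run_of_forwardGenerated` (a first step with `1∕γ² ≤ 1∕g₀² − β 0 (g₀)` IS a run `⟨1, m, g₀⟩` in `]0, γ]`) ·
  ★ `window_of_forwardGenerated_of_firstStep` (W12's first-step condition ⟹ the window) · `firstStep_of_level0Upper` (explicit bare coupling `(γ⁻² + max β⁺ 0)^{−1∕2}`) ·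
  ★ `firstStep_of_sq_mul_le` · `level0Upper_of_eventually_le` · `level0Upper_of_betaUpperH` · ★ `level0Bounds_of_betaBoundsInInterval` · the windows
  `window_of_forwardGenerated_of_level0Upper ∕ _of_sq_mul_le ∕ _of_eventually_le ∕ _of_tendsto ∕ _of_betaBoundsInInterval` · A6 inhabitant `window_modelOf_zeroBeta`
  (§1's binders jointly satisfied at `FlowStepRuns.modelOf` of the zero family — a junk model, NOT Bałaban's β).
* §2 at any `D : FiniteEpsData F G`: `window_of_firstStep`, `window_of_level0Upper`, `window_of_sq_mul_le`, `window_of_eventually_le`, `window_of_tendsto_firstBeta`,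
  `window_of_betaBoundsInInterval`.

HONEST SCOPE (A6, №189).  Elementary flow-side bookkeeping ((0.20) for ONE step against a first-step inequality; quantifier logic); every β-input is a DISPLAYED hypothesis,
none is discharged; nothing of Bałaban's analysis is asserted or used; no node discharged; K1⁷ ∕ K2⁷ NOT closed; no stub closed; counts unmoved (typed 28∕28 · discharged 5∕27 ·
A 5∕28).  One finite four-torus programme at fixed `ε = L^{−K}`, Bałaban AS PRINTED; the YM mass gap (Clay) is NOT proved by any of this — R4 closes the conditional finite-𝕋⁴ rung
`BalabanLadder.UV` only; nothing continuum ∕ ℝ⁴ ∕ OS.  No `instance`, no `notation`, no `axiom`.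
References: [I] = [Balaban1987RG1] CMP **109** (1987) 249–301: (0.17)–(0.20) pp. 255–256, Thm 2 p. 259, (1.20)–(1.22) p. 264, (2.12)–(2.14) p. 268, §5 p. 298.
-/

noncomputable section

namespace Summit.QuantumFields.YangMills.Theorems.BalabanUVNodesK1WindowFirstStep

open Literature.MathematicalPhysics.QuantumFieldTheory.Balaban1983to89
open Literature.MathematicalPhysics.QuantumFieldTheory.Balaban1983to89.FlowStep
open Literature.MathematicalPhysics.QuantumFieldTheory.Balaban1983to89.FlowStepRuns
open Literature.MathematicalPhysics.QuantumFieldTheory.Balaban1983to89.DagBinding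
open Literature.MathematicalPhysics.QuantumFieldTheory.Balaban1983to89.T4Continuum (T4Family FiniteEpsData)
open Filter Topology

/-! ## §1. Flow side: a good FIRST step is a run of length one; the located first-step inputs -/

section Flow

/-- Elementary: for positive `g`, `γ`, `γ⁻² ≤ g⁻²` gives `g ≤ γ`. [folklore] -/
private theorem le_of_one_div_sq_le {g γ : ℝ} (hg : 0 < g) (hγ : 0 < γ) (h : 1 / γ ^ 2 ≤ 1 / g ^ 2) : g ≤ γ := by
  have h2 : g ^ 2 ≤ γ ^ 2 := (one_div_le_one_div (pow_pos hγ 2) (pow_pos hg 2)).1 h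
  nlinarith [h2, hg, hγ]

/-- The constant length-one history `(x)` lies in the box `]0, γ]^1` iff `0 < x ≤ γ`. [cite: Balaban1987RG1, §1 p.264 (the interval `]0, γ]`; bookkeeping)] -/
theorem const_mem_box_zero_iff {γ x : ℝ} : (fun _ : Fin 1 => x) ∈ Box γ 0 ↔ 0 < x ∧ x ≤ γ := by
  rw [mem_box]
  exact ⟨fun h => h 0, fun h _ => h⟩

/-- ★ **A GOOD FIRST STEP IS A ONE-STEP RUN IN THE WINDOW.**  For a forward-generated construction (`DagBinding.ForwardGenerated C β`: `g_0 = g₀` and (0.20) solved forward while its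
right side is positive), a bare coupling `g₀ ∈ ]0, γ]` with `1∕γ² ≤ 1∕g₀² − β 0 (g₀)` gives the run `⟨1, m, g₀⟩` with `g_0, g_1 ∈ ]0, γ]` (`1∕g_1² = 1∕g₀² − β 0 (g₀) ≥ 1∕γ² > 0`).
No halting clause, no later β-function, no sign or continuity is used. [cite: Balaban1987RG1, (0.18)–(0.20) pp.255–256 (elementary)] -/
theorem oneStep_run_of_forwardGenerated (C : B12.Construction) (β : HBeta) (hgen : ForwardGenerated C β) {γ g₀ : ℝ} (hγ : 0 < γ)
    (hg₀ : 0 < g₀) (hg₀γ : g₀ ≤ γ) (hstep : 1 / γ ^ 2 ≤ 1 / g₀ ^ 2 - β 0 (fun _ => g₀)) (m : ℕ) :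
    (C ⟨1, m, g₀⟩).flow.InInterval γ 1 := by
  set P : B12.RunParams := ⟨1, m, g₀⟩ with hPdef
  have hg0 : (C P).flow.g 0 = g₀ := hgen.1 P
  have hpre : prefixOf (C P).flow.g 0 = fun _ => g₀ := by
    funext i
    rw [Subsingleton.elim (α := Fin 1) i 0]
    exact hg0
  have hrhs_ge : 1 / γ ^ 2 ≤ 1 / ((C P).flow.g 0) ^ 2 - β 0 (prefixOf (C P).flow.g 0) := by
    rw [hpre, hg0]
    exact hstep
  have hrhs : 0 < 1 / ((C P).flow.g 0) ^ 2 - β 0 (prefixOf (C P).flow.g 0) := lt_of_lt_of_le (by positivity) hrhs_ge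
  obtain ⟨hpos1, heq⟩ := hgen.2 P 0 Nat.zero_lt_one (fun i hi => by
    obtain rfl : i = 0 := Nat.le_zero.mp hi
    rw [hg0]
    exact hg₀) hrhs
  have hle1 : (C P).flow.g 1 ≤ γ := le_of_one_div_sq_le hpos1 hγ (by rw [heq]; exact hrhs_ge)
  intro k hk
  rcases Nat.le_one_iff_eq_zero_or_eq_one.mp hk with rfl | rfl
  · rw [hg0]
    exact ⟨hg₀, hg₀γ⟩
  · exact ⟨hpos1, hle1⟩

/-- ★ **THE FIRST-STEP CONDITION GIVES THE WINDOW** (any forward-generated construction): «∀ γ ∈ ]0, γ₁], ∃ g₀ ∈ ]0, γ] with `β 0 (g₀) ≤ 1∕g₀² − 1∕γ²`» ⟹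
«∀ γ ∈ ]0, γ₁], ∃ P, 1 ≤ P.K ∧ run in ]0, γ]» — `P := ⟨1, 0, g₀⟩`.  (For GENERATED sequences the converse holds too: node00-def-K0a's `Node00.window_genSeq_iff`, ROW W12.)
[cite: Balaban1987RG1, (0.17)–(0.20) pp.255–256 (elementary)] -/
theorem window_of_forwardGenerated_of_firstStep (C : B12.Construction) (β : HBeta) (hgen : ForwardGenerated C β)
    (h : ∃ γ₁ : ℝ, 0 < γ₁ ∧ ∀ γ : ℝ, 0 < γ → γ ≤ γ₁ →
      ∃ g0 : ℝ, (0 < g0 ∧ g0 ≤ γ) ∧ β 0 (fun _ => g0) ≤ 1 / g0 ^ 2 - 1 / γ ^ 2) :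
    ∃ γ₁ : ℝ, 0 < γ₁ ∧ ∀ γ : ℝ, 0 < γ → γ ≤ γ₁ → ∃ P : B12.RunParams, 1 ≤ P.K ∧ (C P).flow.InInterval γ P.K := by
  obtain ⟨γ₁, hγ₁, h⟩ := h
  refine ⟨γ₁, hγ₁, fun γ hγ hγle => ?_⟩
  obtain ⟨g0, ⟨hg0, hg0γ⟩, hβ⟩ := h γ hγ hγle
  exact ⟨⟨1, 0, g0⟩, le_rfl, oneStep_run_of_forwardGenerated C β hgen hγ hg0 hg0γ (by linarith) 0⟩

/-- **A LEVEL-0 UPPER BOUND GIVES THE FIRST-STEP CONDITION, WITH THE EXPLICIT BARE COUPLING** `g₀ := solveCoupling (γ⁻² + max β⁺ 0) = (γ⁻² + max β⁺ 0)^{−1∕2}`: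
`β 0 (g) ≤ β⁺` for `g ∈ ]0, γ₁]`, `γ₁ > 0` ⟹ for every `γ ∈ ]0, γ₁]`, `g₀ ∈ ]0, γ]` and `β 0 (g₀) ≤ β⁺ ≤ max β⁺ 0 = 1∕g₀² − 1∕γ²`.  The hypothesis is the `k = 0` instance of [I] p. 264
«uniformly bounded on this interval» (proof deferred in print; NODE O). [cite: Balaban1987RG1, (0.18)–(0.20) pp.255–256 and §1 p.264 (elementary consequence)] -/
theorem firstStep_of_level0Upper (β : HBeta) {γ₁ βup : ℝ} (hγ₁ : 0 < γ₁) (hup : ∀ g : ℝ, 0 < g → g ≤ γ₁ → β 0 (fun _ => g) ≤ βup) :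
    ∃ γ₁ : ℝ, 0 < γ₁ ∧ ∀ γ : ℝ, 0 < γ → γ ≤ γ₁ →
      ∃ g0 : ℝ, (0 < g0 ∧ g0 ≤ γ) ∧ β 0 (fun _ => g0) ≤ 1 / g0 ^ 2 - 1 / γ ^ 2 := by
  refine ⟨γ₁, hγ₁, fun γ hγ hγle => ?_⟩
  have hB : 0 ≤ max βup 0 := le_max_right _ _
  have hy : 0 < 1 / γ ^ 2 + max βup 0 := by positivity
  have hpos : 0 < solveCoupling (1 / γ ^ 2 + max βup 0) := solveCoupling_pos hy
  have hsq : 1 / (solveCoupling (1 / γ ^ 2 + max βup 0)) ^ 2 = 1 / γ ^ 2 + max βup 0 := inv_sq_solveCoupling hy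
  have hle : solveCoupling (1 / γ ^ 2 + max βup 0) ≤ γ :=
    le_of_one_div_sq_le hpos hγ (by rw [hsq]; exact le_add_of_nonneg_right hB)
  refine ⟨solveCoupling (1 / γ ^ 2 + max βup 0), ⟨hpos, hle⟩, ?_⟩
  rw [hsq]
  linarith [hup _ hpos (hle.trans hγle), le_max_left βup 0]

/-- ★ **A FIRST β-FUNCTION DIVERGING LIKE `c∕g²`, `c < 1`, IS TOLERATED**: if `g² · β 0 (g) ≤ c` eventually as `g → 0⁺` with `c < 1`, the first-step condition holds
(`g₀ := √(1 − max c 0) · γ`: then `1∕g₀² − β 0 (g₀) ≥ (1 − max c 0)∕g₀² = 1∕γ²`).  So boundedness above is far from necessary; the only obstruction is `β 0 (g) > (1 − o(1))∕g²` along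
`g → 0⁺` (cf. ROW W12's necessary `Node00.sq_mul_betaMerged_lt_one_of_window`). [cite: Balaban1987RG1, (0.18)–(0.20) pp.255–256 and §1 p.264 (elementary)] -/
theorem firstStep_of_sq_mul_le (β : HBeta) {c : ℝ} (hc : c < 1) (h : ∀ᶠ x in 𝓝[>] (0 : ℝ), x ^ 2 * β 0 (fun _ => x) ≤ c) :
    ∃ γ₁ : ℝ, 0 < γ₁ ∧ ∀ γ : ℝ, 0 < γ → γ ≤ γ₁ →
      ∃ g0 : ℝ, (0 < g0 ∧ g0 ≤ γ) ∧ β 0 (fun _ => g0) ≤ 1 / g0 ^ 2 - 1 / γ ^ 2 := by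
  obtain ⟨u, hu, hsub⟩ := mem_nhdsGT_iff_exists_Ioo_subset.mp h
  have hu0 : (0 : ℝ) < u := hu
  set c' : ℝ := max c 0 with hc'
  have hc'1 : c' < 1 := max_lt hc one_pos
  have h1c : 0 < 1 - c' := sub_pos.mpr hc'1
  set s : ℝ := Real.sqrt (1 - c') with hs
  have hs0 : 0 < s := Real.sqrt_pos.mpr h1c
  have hs1 : s ≤ 1 :=
    calc s = Real.sqrt (1 - c') := rfl
      _ ≤ Real.sqrt 1 := Real.sqrt_le_sqrt (by linarith [le_max_right c 0])
      _ = 1 := Real.sqrt_one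
  have hs2 : s ^ 2 = 1 - c' := Real.sq_sqrt h1c.le
  refine ⟨u / 2, by positivity, fun γ hγ hγu => ⟨s * γ, ⟨mul_pos hs0 hγ, ?_⟩, ?_⟩⟩
  · calc s * γ ≤ 1 * γ := mul_le_mul_of_nonneg_right hs1 hγ.le
      _ = γ := one_mul γ
  · have hg₀ : 0 < s * γ := mul_pos hs0 hγ
    have hmem : s * γ ∈ Set.Ioo (0 : ℝ) u := ⟨hg₀, by nlinarith [mul_le_mul_of_nonneg_right hs1 hγ.le]⟩
    have hb : (s * γ) ^ 2 * β 0 (fun _ => s * γ) ≤ c' := (hsub hmem).trans (le_max_left _ _)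
    have hβ : β 0 (fun _ => s * γ) ≤ c' / (s * γ) ^ 2 := by
      rw [le_div_iff₀ (pow_pos hg₀ 2), mul_comm]
      exact hb
    have hkey : 1 / γ ^ 2 = 1 / (s * γ) ^ 2 - c' / (s * γ) ^ 2 := by
      rw [← sub_div, mul_pow, hs2]
      field_simp
    linarith

/-- **EVENTUAL FORM ⟹ LEVEL-0 BOUND**: if `β 0 (x) ≤ b` eventually as `x → 0⁺`, then `β 0 (g) ≤ b` for `g ∈ ]0, γ₁]`, some `γ₁ > 0`. [cite: Balaban1987RG1, §1 p.264 (elementary reformulation)] -/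
theorem level0Upper_of_eventually_le (β : HBeta) {b : ℝ} (h : ∀ᶠ x in 𝓝[>] (0 : ℝ), β 0 (fun _ => x) ≤ b) :
    ∃ γ₁ : ℝ, 0 < γ₁ ∧ ∀ g : ℝ, 0 < g → g ≤ γ₁ → β 0 (fun _ => g) ≤ b := by
  obtain ⟨u, hu, hsub⟩ := mem_nhdsGT_iff_exists_Ioo_subset.mp h
  have hu0 : (0 : ℝ) < u := hu
  exact ⟨u / 2, by positivity, fun g hg hgu => hsub ⟨hg, by linarith⟩⟩

/-- The all-step box bound `FlowStep.BetaUpperH β⁺ γ₀ β` ([I] p. 264 at every `k`; dag-n24-a's input) contains the level-0 bound (its `k = 0` slice at constant histories).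
[cite: Balaban1987RG1, §1 p.264 (bookkeeping)] -/
theorem level0Upper_of_betaUpperH (β : HBeta) {βup γ₀ : ℝ} (h : BetaUpperH βup γ₀ β) :
    ∀ g : ℝ, 0 < g → g ≤ γ₀ → β 0 (fun _ => g) ≤ βup :=
  fun _ hg hgγ => h 0 _ (const_mem_box_zero_iff.mpr ⟨hg, hgγ⟩)

/-- ★ **THE INTERVAL CURRENCY GIVES THE LEVEL-0 BOUNDS.**  For a construction whose run-wise β-functions curry `β` (`DagBinding.CurriesHBeta`, the dictionary clause of every
finite-ε datum), the faithful interval binder `DagBinding.BetaBoundsInInterval C γ₀ b b′` ([I] (1.22) p. 264: `b ≤ β_{j+1}(x) ≤ b′` for `x ∈ ]0, γ₀]` whenever the earlier couplings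
stayed in `]0, γ₀]`) yields at `j = 0` (no earlier coupling; the run `⟨1, 0, 0⟩`) `b ≤ β 0 (g) ≤ b′` for every `g ∈ ]0, γ₀]` — a length-one prefix updated at its last slot is the
constant history. [cite: Balaban1987RG1, §1 (1.22) p.264 (bookkeeping)] -/
theorem level0Bounds_of_betaBoundsInInterval (C : B12.Construction) (β : HBeta) (hcur : CurriesHBeta C β) {γ₀ b b' : ℝ}
    (hβ : BetaBoundsInInterval C γ₀ b b') : ∀ g : ℝ, 0 < g → g ≤ γ₀ → b ≤ β 0 (fun _ => g) ∧ β 0 (fun _ => g) ≤ b' := by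
  intro g hg hgγ
  have h := hβ ⟨1, 0, 0⟩ 0 g Nat.zero_lt_one (fun i hi => absurd hi (Nat.not_lt_zero i)) hg hgγ
  rw [hcur ⟨1, 0, 0⟩ 0 g Nat.zero_lt_one] at h
  have hv : Function.update (prefixOf (C ⟨1, 0, 0⟩).flow.g 0) (Fin.last 0) g = fun _ => g := by
    funext i
    rw [Subsingleton.elim (α := Fin 1) i (Fin.last 0)]
    simp
  rwa [hv] at h

/-- **THE WINDOW FROM A LEVEL-0 UPPER BOUND** (forward-generated construction; runs `⟨1, 0, (γ⁻² + max β⁺ 0)^{−1∕2}⟩`).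
[cite: Balaban1987RG1, (0.17)–(0.20) pp.255–256 and §1 p.264 (elementary consequence)] -/
theorem window_of_forwardGenerated_of_level0Upper (C : B12.Construction) (β : HBeta) (hgen : ForwardGenerated C β) {γ₁ βup : ℝ} (hγ₁ : 0 < γ₁)
    (hup : ∀ g : ℝ, 0 < g → g ≤ γ₁ → β 0 (fun _ => g) ≤ βup) :
    ∃ γ₁ : ℝ, 0 < γ₁ ∧ ∀ γ : ℝ, 0 < γ → γ ≤ γ₁ → ∃ P : B12.RunParams, 1 ≤ P.K ∧ (C P).flow.InInterval γ P.K :=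
  window_of_forwardGenerated_of_firstStep C β hgen (firstStep_of_level0Upper β hγ₁ hup)

/-- **THE WINDOW FROM `g²·β 0 (g) ≤ c < 1` EVENTUALLY AT `0⁺`** (forward-generated construction). [cite: Balaban1987RG1, (0.17)–(0.20) pp.255–256 and §1 p.264 (elementary consequence)] -/
theorem window_of_forwardGenerated_of_sq_mul_le (C : B12.Construction) (β : HBeta) (hgen : ForwardGenerated C β) {c : ℝ} (hc : c < 1)
    (h : ∀ᶠ x in 𝓝[>] (0 : ℝ), x ^ 2 * β 0 (fun _ => x) ≤ c) :
    ∃ γ₁ : ℝ, 0 < γ₁ ∧ ∀ γ : ℝ, 0 < γ → γ ≤ γ₁ → ∃ P : B12.RunParams, 1 ≤ P.K ∧ (C P).flow.InInterval γ P.K :=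
  window_of_forwardGenerated_of_firstStep C β hgen (firstStep_of_sq_mul_le β hc h)

/-- **THE WINDOW FROM AN EVENTUAL UPPER BOUND AT `0⁺`** (forward-generated construction). [cite: Balaban1987RG1, (0.17)–(0.20) pp.255–256 and §1 p.264 (elementary consequence)] -/
theorem window_of_forwardGenerated_of_eventually_le (C : B12.Construction) (β : HBeta) (hgen : ForwardGenerated C β) {b : ℝ}
    (h : ∀ᶠ x in 𝓝[>] (0 : ℝ), β 0 (fun _ => x) ≤ b) :
    ∃ γ₁ : ℝ, 0 < γ₁ ∧ ∀ γ : ℝ, 0 < γ → γ ≤ γ₁ → ∃ P : B12.RunParams, 1 ≤ P.K ∧ (C P).flow.InInterval γ P.K := by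
  obtain ⟨γ₁, hγ₁, hup⟩ := level0Upper_of_eventually_le β h
  exact window_of_forwardGenerated_of_level0Upper C β hgen hγ₁ hup

/-- ★ **THE WINDOW FROM THE EXISTENCE OF THE ONE-SIDED LIMIT OF THE FIRST β-FUNCTION AT `0⁺`** (forward-generated construction): `β 0 (x) → L` as `x → 0⁺` ⟹ `β 0 (x) ≤ L + 1`
eventually ⟹ the window.  A CONTINUITY input ([I] p. 264 β-clause; (2.12)–(2.14) p. 268 «vanishes at g_k = 0» read as a limit), not a uniform bound.
[cite: Balaban1987RG1, §1 p.264 and (2.12)–(2.14) p.268 (elementary consequence)] -/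
theorem window_of_forwardGenerated_of_tendsto (C : B12.Construction) (β : HBeta) (hgen : ForwardGenerated C β) {L : ℝ}
    (h : Tendsto (fun x : ℝ => β 0 (fun _ => x)) (𝓝[>] (0 : ℝ)) (𝓝 L)) :
    ∃ γ₁ : ℝ, 0 < γ₁ ∧ ∀ γ : ℝ, 0 < γ → γ ≤ γ₁ → ∃ P : B12.RunParams, 1 ≤ P.K ∧ (C P).flow.InInterval γ P.K :=
  window_of_forwardGenerated_of_eventually_le C β hgen (h.eventually (eventually_le_nhds (lt_add_one L)))

/-- ★ **THE WINDOW FROM THE INTERVAL CONJUNCT** (forward-generated, curried construction): `BetaBoundsInInterval C γ₀ b b′` with `γ₀ > 0` ⟹ the `K ≥ 1` window — only the upper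
letter `b′` at `j = 0` is read. [cite: Balaban1987RG1, (0.17)–(0.20) pp.255–256 and §1 (1.22) p.264 (elementary consequence)] -/
theorem window_of_forwardGenerated_of_betaBoundsInInterval (C : B12.Construction) (β : HBeta) (hgen : ForwardGenerated C β) (hcur : CurriesHBeta C β)
    {γ₀ b b' : ℝ} (hγ₀ : 0 < γ₀) (hβ : BetaBoundsInInterval C γ₀ b b') :
    ∃ γ₁ : ℝ, 0 < γ₁ ∧ ∀ γ : ℝ, 0 < γ → γ ≤ γ₁ → ∃ P : B12.RunParams, 1 ≤ P.K ∧ (C P).flow.InInterval γ P.K :=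
  window_of_forwardGenerated_of_level0Upper C β hgen hγ₀ fun g hg hgγ => (level0Bounds_of_betaBoundsInInterval C β hcur hβ g hg hgγ).2

/-- **A6 INHABITANT of §1's binders**: for the ZERO family `β ≡ 0` the canonical forward-generated construction `FlowStepRuns.modelOf β` satisfies the level-0 bound with `β⁺ := 0` on
`]0, 1]`, hence the window — the hypotheses of `window_of_forwardGenerated_of_level0Upper` are jointly satisfiable (a junk model, NOT Bałaban's β). [folklore] -/
theorem window_modelOf_zeroBeta :
    ∃ γ₁ : ℝ, 0 < γ₁ ∧ ∀ γ : ℝ, 0 < γ → γ ≤ γ₁ →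
      ∃ P : B12.RunParams, 1 ≤ P.K ∧ (modelOf (fun _ _ => (0 : ℝ)) P).flow.InInterval γ P.K :=
  window_of_forwardGenerated_of_level0Upper (modelOf fun _ _ => (0 : ℝ)) (fun _ _ => 0) (modelOf_forwardGenerated _) one_pos
    fun _ _ _ => le_rfl

end Flow

/-! ## §2. The same at ANY finite-ε datum `D : FiniteEpsData F G` (dictionary fields `D.fwd`, `D.curries`; `D.C.toB12` has the flow of `D.C`) -/

section Datum

variable {F : T4Family} {G : Type*} [GaugeGroup G] [MeasurableSpace G] [HaarData G]

/-- ★ **THE WINDOW OF A FINITE-ε DATUM FROM THE FIRST-STEP CONDITION ON ITS FIRST β-FUNCTION** `D.βfun 0` («∀ small γ, ∃ g₀ ∈ ]0, γ], `D.βfun 0 (g₀) ≤ 1∕g₀² − 1∕γ²`»); every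
datum's flow is forward-generated (`D.fwd`). [cite: Balaban1987RG1, (0.17)–(0.20) pp.255–256 (elementary consequence)] -/
theorem window_of_firstStep (D : FiniteEpsData F G)
    (h : ∃ γ₁ : ℝ, 0 < γ₁ ∧ ∀ γ : ℝ, 0 < γ → γ ≤ γ₁ →
      ∃ g0 : ℝ, (0 < g0 ∧ g0 ≤ γ) ∧ D.βfun 0 (fun _ => g0) ≤ 1 / g0 ^ 2 - 1 / γ ^ 2) :
    ∃ γ₁ : ℝ, 0 < γ₁ ∧ ∀ γ : ℝ, 0 < γ → γ ≤ γ₁ → ∃ P : B12.RunParams, 1 ≤ P.K ∧ (D.C P).flow.InInterval γ P.K :=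
  window_of_forwardGenerated_of_firstStep D.C.toB12 D.βfun D.fwd h

/-- **THE WINDOW OF A FINITE-ε DATUM FROM A LEVEL-0 UPPER BOUND** `D.βfun 0 (g) ≤ β⁺`, `g ∈ ]0, γ₁]`, `γ₁ > 0` — strictly less than the all-step `FlowStep.BetaUpperH` of
dag-n24-a's `Node00.N24_window_allK_of_betaUpperH`. [cite: Balaban1987RG1, (0.17)–(0.20) pp.255–256 and §1 p.264 (elementary consequence)] -/
theorem window_of_level0Upper (D : FiniteEpsData F G) {γ₁ βup : ℝ} (hγ₁ : 0 < γ₁) (hup : ∀ g : ℝ, 0 < g → g ≤ γ₁ → D.βfun 0 (fun _ => g) ≤ βup) :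
    ∃ γ₁ : ℝ, 0 < γ₁ ∧ ∀ γ : ℝ, 0 < γ → γ ≤ γ₁ → ∃ P : B12.RunParams, 1 ≤ P.K ∧ (D.C P).flow.InInterval γ P.K :=
  window_of_forwardGenerated_of_level0Upper D.C.toB12 D.βfun D.fwd hγ₁ hup

/-- **THE WINDOW OF A FINITE-ε DATUM FROM `g²·D.βfun 0 (g) ≤ c < 1` EVENTUALLY AT `0⁺`.** [cite: Balaban1987RG1, (0.17)–(0.20) pp.255–256 and §1 p.264 (elementary consequence)] -/
theorem window_of_sq_mul_le (D : FiniteEpsData F G) {c : ℝ} (hc : c < 1) (h : ∀ᶠ x in 𝓝[>] (0 : ℝ), x ^ 2 * D.βfun 0 (fun _ => x) ≤ c) :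
    ∃ γ₁ : ℝ, 0 < γ₁ ∧ ∀ γ : ℝ, 0 < γ → γ ≤ γ₁ → ∃ P : B12.RunParams, 1 ≤ P.K ∧ (D.C P).flow.InInterval γ P.K :=
  window_of_forwardGenerated_of_sq_mul_le D.C.toB12 D.βfun D.fwd hc h

/-- **THE WINDOW OF A FINITE-ε DATUM FROM AN EVENTUAL UPPER BOUND** of its first β-function at `0⁺`. [cite: Balaban1987RG1, (0.17)–(0.20) pp.255–256 and §1 p.264 (elementary consequence)] -/
theorem window_of_eventually_le (D : FiniteEpsData F G) {b : ℝ} (h : ∀ᶠ x in 𝓝[>] (0 : ℝ), D.βfun 0 (fun _ => x) ≤ b) :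
    ∃ γ₁ : ℝ, 0 < γ₁ ∧ ∀ γ : ℝ, 0 < γ → γ ≤ γ₁ → ∃ P : B12.RunParams, 1 ≤ P.K ∧ (D.C P).flow.InInterval γ P.K :=
  window_of_forwardGenerated_of_eventually_le D.C.toB12 D.βfun D.fwd h

/-- ★ **THE WINDOW OF A FINITE-ε DATUM FROM THE ONE-SIDED LIMIT OF ITS FIRST β-FUNCTION AT `0⁺`.** [cite: Balaban1987RG1, §1 p.264 and (2.12)–(2.14) p.268 (elementary consequence)] -/
theorem window_of_tendsto_firstBeta (D : FiniteEpsData F G) {L : ℝ} (h : Tendsto (fun x : ℝ => D.βfun 0 (fun _ => x)) (𝓝[>] (0 : ℝ)) (𝓝 L)) :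
    ∃ γ₁ : ℝ, 0 < γ₁ ∧ ∀ γ : ℝ, 0 < γ → γ ≤ γ₁ → ∃ P : B12.RunParams, 1 ≤ P.K ∧ (D.C P).flow.InInterval γ P.K :=
  window_of_forwardGenerated_of_tendsto D.C.toB12 D.βfun D.fwd h

/-- ★ **THE WINDOW OF A FINITE-ε DATUM FROM THE INTERVAL BINDER** `BetaBoundsInInterval D.C.toB12 γ₀ b b′`, `γ₀ > 0` (K1⁷ rung 2's currency; only `b′` at `j = 0` is read).
[cite: Balaban1987RG1, (0.17)–(0.20) pp.255–256 and §1 (1.22) p.264 (elementary consequence)] -/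
theorem window_of_betaBoundsInInterval (D : FiniteEpsData F G) {γ₀ b b' : ℝ} (hγ₀ : 0 < γ₀) (hβ : BetaBoundsInInterval D.C.toB12 γ₀ b b') :
    ∃ γ₁ : ℝ, 0 < γ₁ ∧ ∀ γ : ℝ, 0 < γ → γ ≤ γ₁ → ∃ P : B12.RunParams, 1 ≤ P.K ∧ (D.C P).flow.InInterval γ P.K :=
  window_of_forwardGenerated_of_betaBoundsInInterval D.C.toB12 D.βfun D.fwd D.curries hγ₀ hβ

end Datum

/-! ### v1.1 (append-only; pub-ymgap-dag-n13-w4 g0 INTENT-2): FREQUENTLY SUFFICES — along SOME sequence of bare couplings `gₙ → 0⁺` with `gₙ²·β 0 (gₙ) ≤ c < 1` the first-step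
condition holds for EVERY `γ > 0`; with ROW W12's necessary `Node00.sq_mul_betaMerged_lt_one_of_window` the `K ≥ 1` window of a generated flow holds IF `liminf_{g→0⁺} g²·β 0 (g) < 1` and
ONLY IF `g²·β 0 (g) < 1` frequently at `0⁺` — the weakest first-step input, sharp up to the constant (so `…_of_tendsto` above needs only SOME one-sided cluster value, and
`…_of_eventually_le` ∕ `…_of_sq_mul_le` only a sequence).  SIGN CONVENTION (referee dag-ref-M READ-14 NIT): the tree's `DagBinding.ForwardGenerated` ∕ `FlowStepRuns.genSeq` solve
`1∕g_{k+1}² = 1∕g_k² − β k (g_0,…,g_k)` — print's (0.18)∕(0.20) pp. 255–256 with def-T's sign for `β`, consistent with ROW W12 and with every inequality here.  Same HONEST SCOPE as above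
(elementary; nothing of Bałaban's asserted; count-neutral; the YM mass gap (Clay) is NOT proved — R4 closes the conditional finite-𝕋⁴ rung `BalabanLadder.UV` only). -/

/-! ## §3 (v1.1). FREQUENTLY suffices: a SEQUENCE of bare couplings `gₙ → 0⁺` with `gₙ²·β 0 (gₙ) ≤ c < 1` gives the window for EVERY `γ > 0` -/

section Frequently

/-- ★★ **THE FIRST-STEP CONDITION FROM A FREQUENT BOUND `g²·β 0 (g) ≤ c < 1` AT `0⁺`** — `∃ᶠ g in 𝓝[>] 0, g² · β 0 (g) ≤ c` with `c < 1` (i.e. along SOME sequence of bare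
couplings tending to `0⁺`; no eventual ∕ uniform control) ⟹ for EVERY `γ > 0` some `g₀ ∈ ]0, γ]` has `β 0 (g₀) ≤ 1∕g₀² − 1∕γ²` (pick a good `g₀ < √(1 − max c 0)·γ`).  Sharp up to the
constant: ROW W12's `Node00.sq_mul_betaMerged_lt_one_of_window` shows the window forces `g₀²·β 0 (g₀) < 1` along its witnesses. [cite: Balaban1987RG1, (0.18)–(0.20) pp.255–256 and §1 p.264 (elementary)] -/
theorem firstStep_all_of_frequently_sq_mul_le (β : HBeta) {c : ℝ} (hc : c < 1) (h : ∃ᶠ x in 𝓝[>] (0 : ℝ), x ^ 2 * β 0 (fun _ => x) ≤ c) :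
    ∀ γ : ℝ, 0 < γ → ∃ g0 : ℝ, (0 < g0 ∧ g0 ≤ γ) ∧ β 0 (fun _ => g0) ≤ 1 / g0 ^ 2 - 1 / γ ^ 2 := by
  set c' : ℝ := max c 0 with hc'
  have hc'1 : c' < 1 := max_lt hc one_pos
  have h1c : 0 < 1 - c' := sub_pos.mpr hc'1
  set s : ℝ := Real.sqrt (1 - c') with hs
  have hs0 : 0 < s := Real.sqrt_pos.mpr h1c
  have hs1 : s ≤ 1 :=
    calc s = Real.sqrt (1 - c') := rfl
      _ ≤ Real.sqrt 1 := Real.sqrt_le_sqrt (by linarith [le_max_right c 0])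
      _ = 1 := Real.sqrt_one
  have hs2 : s ^ 2 = 1 - c' := Real.sq_sqrt h1c.le
  intro γ hγ
  have hsγ : 0 < s * γ := mul_pos hs0 hγ
  have hlt : ∀ᶠ x in 𝓝[>] (0 : ℝ), x < s * γ := (eventually_lt_nhds hsγ).filter_mono nhdsWithin_le_nhds
  have hpos : ∀ᶠ x in 𝓝[>] (0 : ℝ), 0 < x := eventually_mem_nhdsWithin
  obtain ⟨g0, hb, hg0lt, hg0⟩ := (h.and_eventually (hlt.and hpos)).exists
  have hg0γ : g0 ≤ γ :=
    calc g0 ≤ s * γ := hg0lt.le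
      _ ≤ 1 * γ := mul_le_mul_of_nonneg_right hs1 hγ.le
      _ = γ := one_mul γ
  refine ⟨g0, ⟨hg0, hg0γ⟩, ?_⟩
  have hb' : g0 ^ 2 * β 0 (fun _ => g0) ≤ c' := hb.trans (le_max_left _ _)
  have hβ : β 0 (fun _ => g0) ≤ c' / g0 ^ 2 := by
    rw [le_div_iff₀ (pow_pos hg0 2), mul_comm]
    exact hb'
  -- `(1 - c') ∕ g0² > (1 - c') ∕ (sγ)² = 1∕γ²`
  have hsq : g0 ^ 2 < (s * γ) ^ 2 := by nlinarith
  have hkey : 1 / γ ^ 2 = (1 - c') / (s * γ) ^ 2 := by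
    rw [mul_pow, hs2]
    field_simp
  have hmono : (1 - c') / (s * γ) ^ 2 ≤ (1 - c') / g0 ^ 2 :=
    div_le_div_of_nonneg_left h1c.le (pow_pos hg0 2) hsq.le
  have hsplit : (1 - c') / g0 ^ 2 = 1 / g0 ^ 2 - c' / g0 ^ 2 := by
    rw [← sub_div]
  linarith [hmono, hsplit ▸ hmono]

/-- … hence the first-step condition in ROW W12's `∃ γ₁` currency (any `γ₁ > 0`; here `γ₁ := 1`). [cite: Balaban1987RG1, (0.18)–(0.20) pp.255–256 and §1 p.264 (elementary)] -/
theorem firstStep_of_frequently_sq_mul_le (β : HBeta) {c : ℝ} (hc : c < 1) (h : ∃ᶠ x in 𝓝[>] (0 : ℝ), x ^ 2 * β 0 (fun _ => x) ≤ c) :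
    ∃ γ₁ : ℝ, 0 < γ₁ ∧ ∀ γ : ℝ, 0 < γ → γ ≤ γ₁ →
      ∃ g0 : ℝ, (0 < g0 ∧ g0 ≤ γ) ∧ β 0 (fun _ => g0) ≤ 1 / g0 ^ 2 - 1 / γ ^ 2 :=
  ⟨1, one_pos, fun γ hγ _ => firstStep_all_of_frequently_sq_mul_le β hc h γ hγ⟩

/-- ★ **THE WINDOW FROM A FREQUENT BOUND `g²·β 0 (g) ≤ c < 1` AT `0⁺`** (forward-generated construction; `γ₁ := 1`). [cite: Balaban1987RG1, (0.17)–(0.20) pp.255–256 and §1 p.264 (elementary consequence)] -/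
theorem window_of_forwardGenerated_of_frequently_sq_mul_le (C : B12.Construction) (β : HBeta) (hgen : ForwardGenerated C β) {c : ℝ} (hc : c < 1)
    (h : ∃ᶠ x in 𝓝[>] (0 : ℝ), x ^ 2 * β 0 (fun _ => x) ≤ c) :
    ∃ γ₁ : ℝ, 0 < γ₁ ∧ ∀ γ : ℝ, 0 < γ → γ ≤ γ₁ → ∃ P : B12.RunParams, 1 ≤ P.K ∧ (C P).flow.InInterval γ P.K :=
  window_of_forwardGenerated_of_firstStep C β hgen (firstStep_of_frequently_sq_mul_le β hc h)

variable {F : T4Family} {G : Type*} [GaugeGroup G] [MeasurableSpace G] [HaarData G] in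
/-- ★ **THE WINDOW OF A FINITE-ε DATUM FROM A FREQUENT BOUND** `∃ᶠ g in 𝓝[>] 0, g²·D.βfun 0 (g) ≤ c`, `c < 1` — a SEQUENCE of good bare couplings suffices.
[cite: Balaban1987RG1, (0.17)–(0.20) pp.255–256 and §1 p.264 (elementary consequence)] -/
theorem window_of_frequently_sq_mul_le (D : FiniteEpsData F G) {c : ℝ} (hc : c < 1)
    (h : ∃ᶠ x in 𝓝[>] (0 : ℝ), x ^ 2 * D.βfun 0 (fun _ => x) ≤ c) :
    ∃ γ₁ : ℝ, 0 < γ₁ ∧ ∀ γ : ℝ, 0 < γ → γ ≤ γ₁ → ∃ P : B12.RunParams, 1 ≤ P.K ∧ (D.C P).flow.InInterval γ P.K :=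
  window_of_forwardGenerated_of_frequently_sq_mul_le D.C.toB12 D.βfun D.fwd hc h

end Frequently

end Summit.QuantumFields.YangMills.Theorems.BalabanUVNodesK1WindowFirstStep

end
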